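/- Free lead seat `ym-line-cbag-p1` (prover-ym-line-cbag-p1-g20-0; own crux `BoxFloorAllGroups` stmt-QuantumFields-22254 CLOSED) on the
planner-of-record's LINE 5, route `HankelDensitySplitting`: the route-posited objects of the REGISTERED birth skeleton of crux `HankelDensityFloor`
(stmt-QuantumFields-26618; planner ym-idea-2 g3, HOME/bc/HankelDensityFloor_birth.lean, skeleton sha f0c071d1…) VERBATIM, so that the four registered
stubs `stub_hankelFixedDistanceLower : HankelFixedDistanceLower`, `stub_hankelNearUpper : HankelNearUpper`, `stub_hankelLogConvex : HankelLogConvex`,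
`stub_floorOfDoors : FloorOfDoors` can be landed by name from importable definitions.  Definitions only; no claim.  RECORD-type material (node
`LatticeNonFreezing`); the Yang–Mills mass gap is NOT proved by anything here. -/
import Summits.QuantumFields.YangMills.Theses.HankelDensitySplitting

/-!
# Route `HankelDensitySplitting`, crux `HankelDensityFloor` (stmt-QuantumFields-26618): the skeleton's objects

The crux `HankelDensityFloor`: `∀ ε > 0 ∃ c > 0, β₁ ∀ β ≥ β₁ ∀ μ ∈ infiniteVolumeLimitPoints r.ρ β ∀ n ≥ 1, c β⁻² e^{−ε n} ≤ F_μ(n)` for the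
REFLECTION-PAIRED density correlator `F(n) = t(n) + g(n−1)` (`hF`).  The registered line of record (planner ym-idea-2 g3) is the landed
`XiDiverges` template (`FixedDistanceLower`, `PlaquetteVarianceUpper`, `AxialLogConvexity` ⇒ `xiDivergesOfFixedDistance_proof`) run for the
composite OS vector `[tr F²]^`, with the four doors below as registered stubs:

* `HankelFixedDistanceLower` (stub 1, L): `A/(β² n⁸) ≤ F_μ(n)` for each fixed `n ≥ n₀`, eventually in `β`, uniformly in `μ`;
* `HankelNearUpper` (stub 2, M): `F_μ(1) ≤ B/β²` eventually in `β`;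
* `HankelLogConvex` (stub 3, M): `0 ≤ F(n)`, `F(n+1) ≤ F(n)`, `F(n+1)² ≤ F(n)·F(n+2)` for `n ≥ 1` in every limit state (OS reflection
  positivity for the composite vector);
* `FloorOfDoors` (stub 4, M, pure real analysis): the three doors imply the crux (`LineGoal`).

This file only DECLARES these objects, byte-for-byte as in the registered skeleton (namespace moved from
`…Cruxes.HankelDensityFloor.Birth` to the route's Theorems namespace); the stubs are proved in sibling files `--supports stmt-QuantumFields-26618`.
No summit statement, no mass gap, and not the node `LatticeNonFreezing` is proved by declaring them.
-/

set_option autoImplicit false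

noncomputable section

open MeasureTheory
open Literature.MathematicalPhysics.QuantumLattice
open Literature.MathematicalPhysics.QuantumFieldTheory

namespace Summit.QuantumFields.YangMills.Theorems.HankelDensitySplitting

variable {G : Type} [Group G] [MeasurableSpace G] {N : ℕ}

/-- The reflection-paired density correlator `F_μ(n) = t_μ(n) + g_μ(n−1)` of a state `μ` on `G^{edges(ℤ⁴)}` in the representation `ρ`:
`t(n) = Σ_{0<j} Σ_{k<l} plaquetteCorr ρ μ 0 0 j (n e₀) k l` (temporal plaquettes at the origin against the density at `n e₀`) plus
`g(n−1) = Σ_{0<i<j} Σ_{k<l} plaquetteCorr ρ μ 0 i j ((n−1) e₀) k l` (spatial ones against the density at `(n−1) e₀`) — verbatim the right-hand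
side of the crux `HankelDensityFloor` (registered skeleton of stmt-QuantumFields-26618). -/
def hF (ρ : G →* Matrix (Fin N) (Fin N) ℂ) (μ : Measure (LGConfig 4 G)) (n : ℕ) : ℝ :=
  (∑ j : Fin 4, ∑ k : Fin 4, ∑ l : Fin 4,
      if 0 < j ∧ k < l then plaquetteCorr ρ μ 0 0 j ((n : ℤ) • Pi.single (0 : Fin 4) (1 : ℤ)) k l else 0) +
    (∑ i : Fin 4, ∑ j : Fin 4, ∑ k : Fin 4, ∑ l : Fin 4,
      if 0 < i ∧ i < j ∧ k < l then
        plaquetteCorr ρ μ 0 i j (((n - 1 : ℕ) : ℤ) • Pi.single (0 : Fin 4) (1 : ℤ)) k l else 0)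

/-- STUB 1 of the registered skeleton of stmt-QuantumFields-26618 (the load-bearing door): the fixed-distance polynomial floor for the composite,
`A/(β² n⁸) ≤ F_μ(n)` for every fixed `n ≥ n₀`, eventually in `β`, uniformly over the limit states (cross-plane second-order local law). -/
def HankelFixedDistanceLower : Prop :=
  ∀ (G : Type) [Group G] [TopologicalSpace G] [IsTopologicalGroup G] [CompactSpace G] [MeasurableSpace G]
    [BorelSpace G], IsCompactSimpleLieGroup G → ∀ r : LatticeRep G,
      ∃ A : ℝ, ∃ n₀ : ℕ, 0 < A ∧ 1 ≤ n₀ ∧ ∀ n : ℕ, n₀ ≤ n → ∃ β₁ : ℝ, ∀ β : ℝ, β₁ ≤ β →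
        ∀ μ ∈ infiniteVolumeLimitPoints (d := 4) r.ρ β, A / (β ^ 2 * (n : ℝ) ^ 8) ≤ hF r.ρ μ n

/-- STUB 2 of the registered skeleton of stmt-QuantumFields-26618: the near-distance ceiling `F_μ(1) ≤ B/β²` eventually in `β` (plaquette
variances `O(β⁻²)` in all six planes and Cauchy–Schwarz). -/
def HankelNearUpper : Prop :=
  ∀ (G : Type) [Group G] [TopologicalSpace G] [IsTopologicalGroup G] [CompactSpace G] [MeasurableSpace G]
    [BorelSpace G], IsCompactSimpleLieGroup G → ∀ r : LatticeRep G,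
      ∃ B β₁ : ℝ, 0 < β₁ ∧ ∀ β : ℝ, β₁ ≤ β →
        ∀ μ ∈ infiniteVolumeLimitPoints (d := 4) r.ρ β, hF r.ρ μ 1 ≤ B / β ^ 2

/-- STUB 3 of the registered skeleton of stmt-QuantumFields-26618: reflection positivity for the composite OS vector — `n ↦ F_μ(n)` (`n ≥ 1`)
is non-negative, non-increasing and log-convex in every limit state at every `β ≥ 0`. -/
def HankelLogConvex : Prop :=
  ∀ (G : Type) [Group G] [TopologicalSpace G] [IsTopologicalGroup G] [CompactSpace G] [MeasurableSpace G]
    [BorelSpace G], IsCompactSimpleLieGroup G → ∀ r : LatticeRep G,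
      ∀ β : ℝ, 0 ≤ β → ∀ μ ∈ infiniteVolumeLimitPoints (d := 4) r.ρ β, ∀ n : ℕ, 1 ≤ n →
        0 ≤ hF r.ρ μ n ∧ hF r.ρ μ (n + 1) ≤ hF r.ρ μ n ∧ hF r.ρ μ (n + 1) ^ 2 ≤ hF r.ρ μ n * hF r.ρ μ (n + 2)

/-- The crux `HankelDensityFloor` of route `HankelDensitySplitting` under a local alias (as in the registered skeleton, where only
`HankelDensityFloor_proof` concludes it by name). -/
abbrev LineGoal : Prop := Summit.QuantumFields.YangMills.Theses.HankelDensitySplitting.HankelDensityFloor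

/-- STUB 4 of the registered skeleton of stmt-QuantumFields-26618 (the doors lemma; pure real analysis on log-convex sequences, twin of
`xiDivergesOfFixedDistance_proof`): fixed-distance floor + near ceiling + Hankel log-convexity ⇒ the uniform exponential floor with arbitrarily
small rate. -/
def FloorOfDoors : Prop :=
  HankelFixedDistanceLower → HankelNearUpper → HankelLogConvex → LineGoal

/-- The skeleton's composition (BC3): the four doors give the crux by name.  Recorded here so the Defs file documents how the stubs are consumed;
no stub is proved by this. -/
theorem hankelDensityFloor_of_doors (h₁ : HankelFixedDistanceLower) (h₂ : HankelNearUpper) (h₃ : HankelLogConvex)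
    (h₄ : FloorOfDoors) : LineGoal :=
  h₄ h₁ h₂ h₃

end Summit.QuantumFields.YangMills.Theorems.HankelDensitySplitting

end
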